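import Mathlib
import HarnessLib

/-!
# THETA certificate, tier 2 input E4 (core): the LAG-CELL CONVOLUTION bound (RH-FREE real-analysis bookkeeping)

Cell `rh-explicit`, WEIL column, seat weil-1 gen20 (cc-s2-1 gen22 TIER2-KERNEL-SPEC §2 «Cross term (E4/E5)»). The tier-2 kernel bounds the
convolution value `V_T(−log n)` on the lag cell `log(n/N) ∈ [kτ, (k+1)τ]` by `u₁M₀²·H_k`, `H_k = τ·Σ_{i≤k} env_i·emax_{k−i}`, `emax_0 = env_0`,
`emax_j = max(env_{j−1}, env_j)`, from CELLWISE envelopes `e(t) ≤ env_i` of the tail on the CLOSED depth cells `t ∈ [iτ, (i+1)τ]`: for `t` in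
depth cell `i ≤ k` the partner depth `w − t` lies in cell `k−i−1` or `k−i`. This file proves exactly that inequality, abstractly (no theta
objects; the step `T ↦ e` (E2) and the normalisation stay with the blueprint):

**`integral_mul_sub_le_lagCellSum`**: `τ > 0`, `e ≥ 0` with `e t ≤ env i` on `[iτ, (i+1)τ]` for every `i`, `env ≥ 0`, `kτ ≤ w ≤ (k+1)τ` ⇒
`∫ t in 0..w, e t * e (w − t) ≤ τ * Σ_{i ≤ k} env i * max (env (k−i−1)) (env (k−i))` (ℕ-subtraction: the `i = k` term is `env k · env 0`).

Nothing here bears on the truth of RH.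
-/

noncomputable section

set_option linter.dupNamespace false

open MeasureTheory Set

namespace Summit.RiemannHypothesis.RiemannHypothesis.Theorems.WeilColumn.ThetaPrime

/-- Pointwise core of E4: for `t ∈ [0, w]`, `kτ ≤ w ≤ (k+1)τ`, there is a depth cell `i ≤ k` containing `t` (closed cells), and then the
partner depth `w − t` lies in the closed cell `k−i−1` or `k−i`; hence `e t · e (w−t) ≤ env i · max (env (k−i−1)) (env (k−i))`. [TIER2-KERNEL-SPEC §2 E4] -/
theorem mul_sub_le_of_cellEnvelope {τ w : ℝ} (hτ : 0 < τ) {e : ℝ → ℝ} {env : ℕ → ℝ} {k : ℕ}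
    (he0 : ∀ t, 0 ≤ e t) (henv0 : ∀ i, 0 ≤ env i)
    (he : ∀ (i : ℕ) (t : ℝ), (i : ℝ) * τ ≤ t → t ≤ ((i : ℝ) + 1) * τ → e t ≤ env i)
    (hw1 : (k : ℝ) * τ ≤ w) (hw2 : w ≤ ((k : ℝ) + 1) * τ) {t : ℝ} (ht0 : 0 ≤ t) (htw : t ≤ w) :
    ∃ i ≤ k, (i : ℝ) * τ ≤ t ∧ t ≤ ((i : ℝ) + 1) * τ ∧
      e t * e (w - t) ≤ env i * max (env (k - i - 1)) (env (k - i)) := by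
  -- the cell of `t`
  set i : ℕ := min k ⌊t / τ⌋₊ with hi
  have hik : i ≤ k := min_le_left _ _
  have hcell : (i : ℝ) * τ ≤ t ∧ t ≤ ((i : ℝ) + 1) * τ := by
    have hfl : (⌊t / τ⌋₊ : ℝ) ≤ t / τ := Nat.floor_le (div_nonneg ht0 hτ.le)
    have hfl' : t / τ < (⌊t / τ⌋₊ : ℝ) + 1 := Nat.lt_floor_add_one _
    rcases le_or_gt ⌊t / τ⌋₊ k with h | h
    · have : i = ⌊t / τ⌋₊ := by rw [hi, min_eq_right h]
      rw [this]
      constructor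
      · have := mul_le_mul_of_nonneg_right hfl hτ.le
        rwa [div_mul_cancel₀ _ hτ.ne'] at this
      · have := mul_le_mul_of_nonneg_right hfl'.le hτ.le
        rwa [div_mul_cancel₀ _ hτ.ne'] at this
    · have : i = k := by rw [hi, min_eq_left h.le]
      rw [this]
      refine ⟨?_, htw.trans hw2⟩
      have hk1 : (k : ℝ) + 1 ≤ ⌊t / τ⌋₊ := by exact_mod_cast h
      have : ((k : ℝ) + 1) * τ ≤ t := by
        have := mul_le_mul_of_nonneg_right (hk1.trans hfl) hτ.le
        rwa [div_mul_cancel₀ _ hτ.ne'] at this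
      nlinarith
  refine ⟨i, hik, hcell.1, hcell.2, ?_⟩
  -- the partner depth `s = w - t`
  have het : e t ≤ env i := he i t hcell.1 hcell.2
  have hlow : ((k - i - 1 : ℕ) : ℝ) * τ ≤ w - t := by
    rcases Nat.lt_or_ge i k with hlt | hge
    · have : ((k - i - 1 : ℕ) : ℝ) = (k : ℝ) - i - 1 := by
        rw [Nat.cast_sub (by omega), Nat.cast_sub hlt.le]; push_cast; ring
      rw [this]; nlinarith [hcell.2]
    · have : k - i - 1 = 0 := by omega
      rw [this]; push_cast; linarith
  have hup : w - t ≤ ((k - i : ℕ) : ℝ) * τ + τ := by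
    rw [Nat.cast_sub hik]; nlinarith [hcell.1]
  have hes : e (w - t) ≤ max (env (k - i - 1)) (env (k - i)) := by
    rcases le_or_gt (w - t) (((k - i : ℕ) : ℝ) * τ) with h | h
    · -- cell `k - i - 1`
      refine le_trans (he (k - i - 1) (w - t) hlow ?_) (le_max_left _ _)
      rcases Nat.lt_or_ge i k with hlt | hge
      · have e1 : ((k - i - 1 : ℕ) : ℝ) + 1 = ((k - i : ℕ) : ℝ) := by
          have : k - i = (k - i - 1) + 1 := by omega
          rw [this, Nat.cast_add_one, Nat.add_sub_cancel]
        rw [e1]; exact h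
      · have h0 : k - i = 0 := by omega
        have h1 : k - i - 1 = 0 := by omega
        rw [h0] at h; rw [h1]; push_cast at h ⊢; linarith
    · -- cell `k - i`
      exact le_trans (he (k - i) (w - t) h.le (by linarith)) (le_max_right _ _)
  exact mul_le_mul het hes (he0 _) (henv0 _)

/-- **E4 (core) — THE LAG-CELL CONVOLUTION BOUND.** Let `τ > 0`, `e ≥ 0` with `e t ≤ env i` on every CLOSED depth cell `[iτ, (i+1)τ]`,
`env ≥ 0`, and `w` in lag cell `k` (`kτ ≤ w ≤ (k+1)τ`); assume `t ↦ e t · e (w − t)` is interval-integrable on `[0, w]`. Then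
`∫ t in 0..w, e t · e (w − t) ≤ τ · Σ_{i ≤ k} env i · max (env (k−i−1)) (env (k−i))` — the kernel's `H_k = τ·Σ_{i≤k} env_i·emax_{k−i}`
with `emax_0 = env_0`, `emax_j = max(env_{j−1}, env_j)`. [TIER2-KERNEL-SPEC §2 E4; folklore] -/
theorem integral_mul_sub_le_lagCellSum {τ w : ℝ} (hτ : 0 < τ) {e : ℝ → ℝ} {env : ℕ → ℝ} {k : ℕ}
    (he0 : ∀ t, 0 ≤ e t) (henv0 : ∀ i, 0 ≤ env i)
    (he : ∀ (i : ℕ) (t : ℝ), (i : ℝ) * τ ≤ t → t ≤ ((i : ℝ) + 1) * τ → e t ≤ env i)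
    (hw1 : (k : ℝ) * τ ≤ w) (hw2 : w ≤ ((k : ℝ) + 1) * τ)
    (hint : IntervalIntegrable (fun t ↦ e t * e (w - t)) volume 0 w) :
    ∫ t in (0 : ℝ)..w, e t * e (w - t) ≤
      τ * ∑ i ∈ Finset.range (k + 1), env i * max (env (k - i - 1)) (env (k - i)) := by
  have hw0 : 0 ≤ w := le_trans (by positivity) hw1
  -- the step majorant
  set c : ℕ → ℝ := fun i ↦ env i * max (env (k - i - 1)) (env (k - i)) with hc
  have hc0 : ∀ i, 0 ≤ c i := fun i ↦ mul_nonneg (henv0 i) (le_trans (henv0 _) (le_max_right _ _))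
  set g : ℝ → ℝ := fun t ↦ ∑ i ∈ Finset.range (k + 1), c i * (Set.Icc ((i : ℝ) * τ) (((i : ℝ) + 1) * τ)).indicator 1 t
    with hg
  -- pointwise domination on `[0, w]`
  have hdom : ∀ t ∈ Set.Icc 0 w, e t * e (w - t) ≤ g t := by
    intro t ht
    obtain ⟨i, hik, h1, h2, hle⟩ := mul_sub_le_of_cellEnvelope hτ he0 henv0 he hw1 hw2 ht.1 ht.2
    have hmem : t ∈ Set.Icc ((i : ℝ) * τ) (((i : ℝ) + 1) * τ) := ⟨h1, h2⟩
    have hi' : i ∈ Finset.range (k + 1) := Finset.mem_range.2 (Nat.lt_succ_of_le hik)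
    calc e t * e (w - t) ≤ c i := hle
      _ = c i * (Set.Icc ((i : ℝ) * τ) (((i : ℝ) + 1) * τ)).indicator 1 t := by
          rw [Set.indicator_of_mem hmem, Pi.one_apply, mul_one]
      _ ≤ g t := by
          rw [hg]
          exact Finset.single_le_sum (f := fun j ↦ c j * (Set.Icc ((j : ℝ) * τ) (((j : ℝ) + 1) * τ)).indicator 1 t)
            (fun j _ ↦ mul_nonneg (hc0 j) (Set.indicator_nonneg (fun _ _ ↦ zero_le_one) _)) hi'
  -- integrability of the step majorant
  have hind : ∀ i : ℕ, Integrable (fun t : ℝ ↦ (Set.Icc ((i : ℝ) * τ) (((i : ℝ) + 1) * τ)).indicator (1 : ℝ → ℝ) t) := fun i ↦ by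
    refine (integrable_indicator_iff measurableSet_Icc).2 ?_
    exact integrableOn_const (by rw [Real.volume_Icc]; exact ENNReal.ofReal_ne_top)
  have hgint : IntervalIntegrable g volume 0 w := by
    rw [hg]
    exact (integrable_finsetSum (Finset.range (k + 1)) fun i _ ↦ (hind i).const_mul (c i)).intervalIntegrable
  -- compare the integrals
  have hmono : ∫ t in (0 : ℝ)..w, e t * e (w - t) ≤ ∫ t in (0 : ℝ)..w, g t :=
    intervalIntegral.integral_mono_on hw0 hint hgint hdom
  refine hmono.trans ?_
  -- integrate the step function cell by cell
  have hcellint : ∀ i : ℕ, ∫ t in (0 : ℝ)..w, (Set.Icc ((i : ℝ) * τ) (((i : ℝ) + 1) * τ)).indicator (1 : ℝ → ℝ) t ≤ τ := by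
    intro i
    rw [intervalIntegral.integral_of_le hw0, setIntegral_indicator measurableSet_Icc]
    rw [show (fun _ : ℝ ↦ (1 : ℝ → ℝ) _) = fun _ ↦ (1 : ℝ) from rfl, setIntegral_const, smul_eq_mul, mul_one]
    have hsub : Set.Ioc 0 w ∩ Set.Icc ((i : ℝ) * τ) (((i : ℝ) + 1) * τ) ⊆ Set.Icc ((i : ℝ) * τ) (((i : ℝ) + 1) * τ) :=
      Set.inter_subset_right
    have hvol : volume (Set.Icc ((i : ℝ) * τ) (((i : ℝ) + 1) * τ)) = ENNReal.ofReal τ := by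
      rw [Real.volume_Icc]; congr 1; ring
    calc (volume (Set.Ioc 0 w ∩ Set.Icc ((i : ℝ) * τ) (((i : ℝ) + 1) * τ))).toReal
        ≤ (volume (Set.Icc ((i : ℝ) * τ) (((i : ℝ) + 1) * τ))).toReal :=
          ENNReal.toReal_mono (by rw [hvol]; exact ENNReal.ofReal_ne_top) (measure_mono hsub)
      _ = τ := by rw [hvol, ENNReal.toReal_ofReal hτ.le]
  rw [hg, intervalIntegral.integral_finsetSum (fun i _ ↦ ((hind i).const_mul (c i)).intervalIntegrable)]
  rw [Finset.mul_sum]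
  refine Finset.sum_le_sum fun i _ ↦ ?_
  rw [intervalIntegral.integral_const_mul]
  calc c i * ∫ t in (0 : ℝ)..w, (Set.Icc ((i : ℝ) * τ) (((i : ℝ) + 1) * τ)).indicator (1 : ℝ → ℝ) t
      ≤ c i * τ := mul_le_mul_of_nonneg_left (hcellint i) (hc0 i)
    _ = τ * (env i * max (env (k - i - 1)) (env (k - i))) := by rw [hc]; ring

end Summit.RiemannHypothesis.RiemannHypothesis.Theorems.WeilColumn.ThetaPrime

end
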